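import Summits.QuantumAdvantage.QuantumAdvantage.Theorems.LinnikCubicClassGroupsDegreeOnePrimesEscapePermutationType
import Summits.QuantumAdvantage.QuantumAdvantage.Theorems.LinnikCubicClassGroupsDegreeOnePrimesEscapeConjClassIntervalsAll
import HarnessLib

/-!
# Every splitting type of every number field occurs in every interval `(x, 2x]`, `x ≥ |d_K|^L`

Topic `Summits/QuantumAdvantage/QuantumAdvantage/Theorems`, cell B2b-1 (linnik-cubic), PART A (gen 14);
helper toward the crux `DegreeOnePrimesEscape` (stmt-QuantumAdvantage-11543) of route
`LinnikCubicClassGroups`.  HONEST FRAMING: the value of this file is a THEOREM (kernel-checked, GRH-free,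
Siegel-free, no hypothesis) — NOT summit progress.

For a number field `K` of degree `n` with Galois-closure data `(N, f, ψ)` (`N ⊇ f(K)` Galois, `[N:ℚ] ≤ n!`,
`|d_N| ≤ |d_K|^{[N:ℚ]}`, `ψ : Gal(N/ℚ) → S_n` with `Gal(N/fK) = Stab(0)`; `exists_galoisClosure_perm`)
the splitting types of the unramified primes of `K` are exactly the full cycle types of the `ψ σ`,
`σ ∈ Gal(N/ℚ)` (Dedekind, `frobenius_mem_cycleTypeSet_iff`).  From the Bertrand postulate for Frobenius
classes (`exists_frobenius_isConj_mem_Ioc_all`):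

* `exists_prime_splittingType_mem_Ioc` — for `n > 1` there is `L > 0` such that for every such
  `K, N, f, ψ`, every `σ` and every `x ≥ |d_K|^L` there is a prime `p ∈ (x, 2x]`, `p ∤ d_K`, whose
  splitting type in `K` is the full cycle type of `ψ σ`;
* `exists_prime_splittingType_le` — in particular such a prime `p ≤ |d_K|^L` exists (the least prime
  with a given splitting type, [LagariasMontgomeryOdlyzko1979, Thm 1.1] for an arbitrary number field,
  in cycle-type language; compare the Perlis-sum form `exists_prime_splittingType_le_of_embedding`).
-/

noncomputable section

open scoped NumberField nonZeroDivisors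
open Finset Real Ideal NumberField
open Literature.NumberTheory.NumberFields Literature.NumberTheory.LFunctions
  Literature.NumberTheory.LFunctions.NumberField

namespace Summit.QuantumAdvantage.QuantumAdvantage.Theorems.DegreeOnePrimesEscape

set_option maxHeartbeats 1600000 in
/-- **Every splitting type in every interval `(x, 2x]`, `x ≥ |d_K|^L`, for every number field** (see the
module docstring).  Unconditional. [cite: LagariasMontgomeryOdlyzko1979, Theorem 1.1] [cite: Perlis1977, §1] -/
theorem exists_prime_splittingType_mem_Ioc (n : ℕ) [NeZero n] (hn : 1 < n) :
    ∃ L : ℝ, 0 < L ∧ ∀ (K : Type) [Field K] [NumberField K], Module.finrank ℚ K = n →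
      ∀ (N : Type) [Field N] [NumberField N] [IsGalois ℚ N] (f : K →ₐ[ℚ] N),
        Module.finrank ℚ N ≤ n.factorial →
        (NumberField.discr N).natAbs ≤ (NumberField.discr K).natAbs ^ Module.finrank ℚ N →
        ∀ ψ : (N ≃ₐ[ℚ] N) →* Equiv.Perm (Fin n),
          (∀ g : N ≃ₐ[ℚ] N, g ∈ f.fieldRange.fixingSubgroup ↔ ψ g 0 = 0) →
          ∀ σ : N ≃ₐ[ℚ] N, ∀ x : ℝ, ((NumberField.discr K).natAbs : ℝ) ^ L ≤ x →
            ∃ p : ℕ, p.Prime ∧ x < p ∧ (p : ℝ) ≤ 2 * x ∧ ¬ ((p : ℤ) ∣ NumberField.discr K) ∧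
              splittingType K p = (ψ σ).cycleType + Multiset.replicate (n - (ψ σ).support.card) 1 := by
  classical
  -- one exponent for every possible degree `m ≤ n!` of `N`
  have hdeg : ∀ m : ℕ, ∃ L : ℝ, 0 < L ∧ (1 < m → ∀ (N : Type) [Field N] [NumberField N]
      [IsGalois ℚ N], Module.finrank ℚ N = m → ∀ σ : N ≃ₐ[ℚ] N, ∀ x : ℝ,
        ((NumberField.discr N).natAbs : ℝ) ^ L ≤ x →
        ∃ p : ℕ, p.Prime ∧ x < p ∧ (p : ℝ) ≤ 2 * x ∧ ¬ ((p : ℤ) ∣ NumberField.discr N) ∧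
          ∃ (Q : Ideal (𝓞 N)) (_ : Q.IsMaximal) (_ : Q.LiesOver (span {(p : ℤ)})) (φ g : N ≃ₐ[ℚ] N),
            IsArithFrobAt ℤ φ Q ∧ Q.inertia (N ≃ₐ[ℚ] N) = ⊥ ∧ g * φ * g⁻¹ = σ) := by
    intro m
    by_cases hm : 1 < m
    · obtain ⟨L, hL, h⟩ := exists_frobenius_isConj_mem_Ioc_all m hm
      exact ⟨L, hL, fun _ => h⟩
    · exact ⟨1, one_pos, fun h => absurd h hm⟩
  choose Lf hLf hthm using hdeg
  set L : ℝ := (n.factorial : ℝ) * ∑ m ∈ Finset.range (n.factorial + 1), Lf m with hL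
  have hsum1 : ∀ m ≤ n.factorial, Lf m ≤ ∑ m ∈ Finset.range (n.factorial + 1), Lf m := fun m hm =>
    Finset.single_le_sum (f := Lf) (fun i _ => (hLf i).le) (Finset.mem_range.mpr (Nat.lt_succ_of_le hm))
  have hfac1 : (1 : ℝ) ≤ n.factorial := by exact_mod_cast Nat.succ_le_of_lt (Nat.factorial_pos n)
  have hLpos : 0 < L := by
    have : 0 < ∑ m ∈ Finset.range (n.factorial + 1), Lf m :=
      lt_of_lt_of_le (hLf 0) (hsum1 0 (Nat.zero_le _))
    rw [hL]; positivity
  refine ⟨L, hLpos, fun K _ _ hK N _ _ _ f hNle hdN ψ hstab σ x hx => ?_⟩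
  set m := Module.finrank ℚ N with hm
  have hKf : Module.finrank ℚ f.fieldRange = n := by
    rw [← hK]; exact (f.equivFieldRange.toLinearEquiv.finrank_eq).symm
  have hKN : n ≤ m := by
    rw [← hKf]
    have h2 := Module.finrank_mul_finrank ℚ f.fieldRange N
    have hpos : 0 < Module.finrank f.fieldRange N := Module.finrank_pos
    exact le_of_le_of_eq (Nat.le_mul_of_pos_right _ hpos) h2
  have hm1 : 1 < m := lt_of_lt_of_le hn hKN
  -- sizes: `|d_N|^{L(m)} ≤ |d_K|^{m L(m)} ≤ |d_K|^L ≤ x`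
  set d : ℝ := ((NumberField.discr K).natAbs : ℝ) with hd
  have hd3 : (3 : ℝ) ≤ d := three_le_natAbs_discr_real K (by rw [hK]; exact hn)
  have hd1 : (1 : ℝ) ≤ d := by linarith
  have hdNR : ((NumberField.discr N).natAbs : ℝ) ≤ d ^ (m : ℝ) := by
    rw [Real.rpow_natCast, hd]; exact_mod_cast hdN
  have hxN : ((NumberField.discr N).natAbs : ℝ) ^ Lf m ≤ x := by
    have h3 : (m : ℝ) * Lf m ≤ L := by
      rw [hL]
      have hmf : (m : ℝ) ≤ n.factorial := by exact_mod_cast hNle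
      exact mul_le_mul hmf (hsum1 m hNle) (hLf m).le (by positivity)
    calc ((NumberField.discr N).natAbs : ℝ) ^ Lf m ≤ (d ^ (m : ℝ)) ^ Lf m :=
          Real.rpow_le_rpow (Nat.cast_nonneg _) hdNR (hLf m).le
      _ = d ^ ((m : ℝ) * Lf m) := by rw [← Real.rpow_mul (by linarith)]
      _ ≤ d ^ L := Real.rpow_le_rpow_of_exponent_le hd1 h3
      _ ≤ x := hx
  obtain ⟨p, hp, hxp, hp2, hpN, Q, hQ, hQp, φ, g, hφ, hI, hg⟩ := hthm m hm1 N rfl σ x hxN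
  -- `p ∤ d_K`, and the splitting type of `p` in `K` is the full cycle type of `ψ φ = ψ (g⁻¹ σ g)`
  have hdisc' : NumberField.discr f.fieldRange = NumberField.discr K :=
    (NumberField.discr_eq_discr_of_algEquiv K f.equivFieldRange).symm
  have hdvd : ¬ ((p : ℤ) ∣ NumberField.discr K) := fun h =>
    hpN (h.trans (hdisc' ▸ NumberField.discr_dvd_discr f.fieldRange N))
  refine ⟨p, hp, hxp, hp2, hdvd, ?_⟩
  haveI := hQ
  haveI := hQp
  rw [ArithmeticallyEquivalent.of_algEquiv f.equivFieldRange p hp,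
    splittingType_eq_fullCycleType_of_hom f.fieldRange ψ hstab hKf hp Q hφ hI, ← hg]
  exact (fullCycleType_conj ψ φ g).symm

/-- **The least prime with a given splitting type, for every number field**: for `n > 1` there is `L > 0`
such that for every number field `K` of degree `n` with Galois-closure data `(N, f, ψ)` and every
`σ ∈ Gal(N/ℚ)` there is a prime `p ≤ |d_K|^L`, `p ∤ d_K`, whose splitting type in `K` is the full cycle
type of `ψ σ`.  Unconditional. [cite: LagariasMontgomeryOdlyzko1979, Theorem 1.1] [cite: Perlis1977, §1] -/
theorem exists_prime_splittingType_le (n : ℕ) [NeZero n] (hn : 1 < n) :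
    ∃ L : ℝ, 0 < L ∧ ∀ (K : Type) [Field K] [NumberField K], Module.finrank ℚ K = n →
      ∀ (N : Type) [Field N] [NumberField N] [IsGalois ℚ N] (f : K →ₐ[ℚ] N),
        Module.finrank ℚ N ≤ n.factorial →
        (NumberField.discr N).natAbs ≤ (NumberField.discr K).natAbs ^ Module.finrank ℚ N →
        ∀ ψ : (N ≃ₐ[ℚ] N) →* Equiv.Perm (Fin n),
          (∀ g : N ≃ₐ[ℚ] N, g ∈ f.fieldRange.fixingSubgroup ↔ ψ g 0 = 0) →
          ∀ σ : N ≃ₐ[ℚ] N,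
            ∃ p : ℕ, p.Prime ∧ (p : ℝ) ≤ ((NumberField.discr K).natAbs : ℝ) ^ L ∧
              ¬ ((p : ℤ) ∣ NumberField.discr K) ∧
              splittingType K p = (ψ σ).cycleType + Multiset.replicate (n - (ψ σ).support.card) 1 := by
  obtain ⟨L₀, hL₀, h⟩ := exists_prime_splittingType_mem_Ioc n hn
  refine ⟨L₀ + 1, by linarith, fun K _ _ hK N _ _ _ f hNle hdN ψ hstab σ => ?_⟩
  set d : ℝ := ((NumberField.discr K).natAbs : ℝ) with hd
  have hd3 : (3 : ℝ) ≤ d := three_le_natAbs_discr_real K (by rw [hK]; exact hn)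
  have hd0 : (0 : ℝ) < d := by linarith
  obtain ⟨p, hp, -, hp2, hnd, hT⟩ := h K hK N f hNle hdN ψ hstab σ (d ^ L₀) le_rfl
  refine ⟨p, hp, hp2.trans ?_, hnd, hT⟩
  rw [Real.rpow_add hd0, Real.rpow_one, mul_comm]
  exact mul_le_mul_of_nonneg_left (by linarith) (Real.rpow_nonneg hd0.le _)

end Summit.QuantumAdvantage.QuantumAdvantage.Theorems.DegreeOnePrimesEscape

end
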